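import Summits.Langlands.Langlands.Theses.RamifiedCoefficientSeed
import Summits.Langlands.Langlands.Theorems.IrreducibilityBySelfDualityReciprocityUpToIrreducibilityCorrespondsConj
import Literature.NumberTheory.Automorphic.ChebotarevArtinRepHolds
import Literature.NumberTheory.GaloisRepresentations.FramedRepEquivConj

/-!
# `RamifiedCoefficientSeed.SectorComplement` (stmt-Langlands-16781) — the registered line's stubs are summit-implied

Disprover's `-- Targets` certificate (cdisprove cycle 1, 2026-08-17) for the crux
`SectorComplement := NonPolarisableFamilyAutomorphic → Langlands` (route RamifiedCoefficientSeed, rank 5, the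
declared out-of-scope remainder).  The item's REGISTERED skeleton `Cruxes/SectorComplement/Lines/
birth_RamifiedCoefficientSeed.lean` (sha d02cc421…, planner-rrepair e75b8072) decomposes the crux into seven
stubs — W `stub_weakExistence`, B_w⁻ `stub_weakAutomorphyOffSector`, B_w⁺ `stub_nonSelfDualRankThreeAutomorphy`
(the home sector in ∀-form), LGC `stub_pairCompatibility` (every `𝓡`), RD `stub_reciprocityData`, and the two
Jacquet–Shalika Literature facts — and its composition `SectorComplement_of` binds the route target as `_hX`
without using it: the line proves the summit outright.  This file certifies, on the VERBATIM stub texts, that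
each of the five non-JS stubs is a CONSEQUENCE of the audited formal summit `_root_.Langlands`, and records the
contrapositive `¬ stub → ¬ Langlands`: NO STUB OF THE LINE IS KILLABLE WITHOUT REFUTING THE SUMMIT, so there is
nothing on it for a disprover to target (the two JS stubs are `JacquetShalika1981_partialPairL_{boundary,pole}_
repData` = items stmt-Langlands-13622 / stmt-Langlands-19093 verbatim, vetted on those items).

* `ramifiedCoefficientSeed_stubWeakExistence_of_langlands` / `…_not_langlands_of_not_stubWeakExistence` — W is
  (A) minus irreducibility, local–global compatibility and uniqueness (`𝓡.pst` is the pinned Fontaine datum by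
  definition, so `IsGeometricFramed 𝓡 ρ` is the stub's pinned-geometric clause; `Corresponds.1` is its a.e. Satake
  clause);
* `ramifiedCoefficientSeed_stubWeakAutomorphyOffSector_of_langlands` / `…_not_…` and
  `ramifiedCoefficientSeed_stubNonSelfDualRankThreeAutomorphy_of_langlands` / `…_not_…` — the two halves of
  (B)-weak (the sector exclusion, resp. the degree-one and non-self-duality hypotheses, are unused); NB the
  home-sector stub is Fontaine–Mazur–Langlands for EVERY irreducible geometric non-essentially-self-dual rank-3
  `ρ` over a field of degree 1, far more than the route's cruxes r2–r4 deliver (one explicit family);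
* `ramifiedCoefficientSeed_stubPairCompatibility_of_langlands` / `…_not_…` — LGC at every finite place for every
  `𝓡`: (A) gives a corresponding avatar `ρ₀`; `ρ`, `ρ₀` irreducible ⇒ semisimple; equal Satake parameters a.e.
  (`AutomorphicRepData.hasSatakeParamAt_unique_holds`) ⇒ equal Frobenius polynomials a.e. ⇒ equivalent
  (Chebotarev + Brauer–Nesbitt, `FramedGaloisRep.nonempty_equiv_of_hasFrobCharpolyAt_eventually
  chebotarev_artinRep_holds`) ⇒ `ρ = P ρ₀ P⁻¹` (`FramedRep.exists_eq_conj_of_equiv`) ⇒ `Corresponds` transports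
  (`ReciprocityUpToIrreducibility.corresponds_conj`, landed for crux 14328);
* `ramifiedCoefficientSeed_stubReciprocityData_of_langlands` / `…_not_…` — RD is the summit's first conjunct
  (its failure = an unsatisfiable `LocalLanglandsDatum (K_v)` as typed = the Statement's own fail-safe).

Nothing here asserts the crux, the target, a stub or the summit.  Work file: `Cruxes/SectorComplement/
Disproof.lean`, PART III §R8.
-/

set_option linter.dupNamespace false -- project-wide option; `Summit.Langlands.Langlands` is the mandated namespace

namespace Summit.Langlands.Langlands.Theorems

open Summit.Langlands.Langlands.Theses.RamifiedCoefficientSeed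
open Literature.NumberTheory.GaloisRepresentations Literature.NumberTheory.Automorphic

/-- **stub W (`stub_weakExistence`) is summit-implied**: (A) of the summit minus irreducibility, local–global
compatibility and uniqueness (`IsGeometricFramed 𝓡 ρ` is the pinned geometric clause since `𝓡.pst` is the
pinned datum by definition; `Corresponds.1` is the a.e. Satake clause). [folklore] -/
theorem ramifiedCoefficientSeed_stubWeakExistence_of_langlands (hL : _root_.Langlands) : ∀ (K : Type) [Field K] [NumberField K] (n : ℕ) (hcpt : Literature.NumberTheory.Automorphic.isCompact_glFiniteIntegralLevel n K), 0 < n → ∀ π : Literature.NumberTheory.Automorphic.CuspidalAutomorphicRepData n K hcpt, π.1.IsLAlgebraic → ∀ (ℓ : ℕ) [Fact ℓ.Prime] (ι : PadicAlgCl ℓ ≃+* ℂ), ∃ ρ : Literature.NumberTheory.GaloisRepresentations.FramedGaloisRep K (PadicAlgCl ℓ) n, ((∀ᶠ v : IsDedekindDomain.HeightOneSpectrum (NumberField.RingOfIntegers K) in Filter.cofinite, ρ.IsUnramifiedAt v) ∧ ∀ (v : IsDedekindDomain.HeightOneSpectrum (NumberField.RingOfIntegers K)) (hv : ((ℓ :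 ℕ) : NumberField.RingOfIntegers K) ∈ v.asIdeal), (Literature.NumberTheory.PAdicHodge.fontainePstAdicCompletion v ℓ hv).IsDeRhamFramed (ρ.toLocal v)) ∧ ∀ᶠ v : IsDedekindDomain.HeightOneSpectrum (NumberField.RingOfIntegers K) in Filter.cofinite, Summit.Langlands.SatakeFrobCompatibleAt ι π.1 ρ v := by
  intro K _ _ n hcpt hn π hLalg ℓ _ ι
  obtain ⟨⟨𝓡⟩, h⟩ := hL K
  obtain ⟨ρ, -, hgeo, hcorr, -⟩ := (h 𝓡 n hn hcpt).1 π hLalg ℓ ι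
  exact ⟨ρ, ⟨hgeo.1, fun v hv ↦ hgeo.2 v hv⟩, hcorr.1⟩

/-- … so a counterexample to stub W refutes the formal summit. [folklore] -/
theorem ramifiedCoefficientSeed_not_langlands_of_not_stubWeakExistence (h : ¬ ∀ (K : Type) [Field K] [NumberField K] (n : ℕ) (hcpt : Literature.NumberTheory.Automorphic.isCompact_glFiniteIntegralLevel n K), 0 < n → ∀ π : Literature.NumberTheory.Automorphic.CuspidalAutomorphicRepData n K hcpt, π.1.IsLAlgebraic → ∀ (ℓ : ℕ) [Fact ℓ.Prime] (ι : PadicAlgCl ℓ ≃+* ℂ), ∃ ρ : Literature.NumberTheory.GaloisRepresentations.FramedGaloisRep K (PadicAlgCl ℓ) n, ((∀ᶠ v : IsDedekindDomain.HeightOneSpectrum (NumberField.RingOfIntegers K) in Filter.cofinite, ρ.IsUnramifiedAt v) ∧ ∀ (v : IsDedekindDomain.HeightOneSpectrum (NumberField.RingOfIntegers K)) (hv : ((ℓ : ℕ) : NumberField.RingOfIntegers K) ∈ v.asIdeal), (Literature.NumberTheory.PAdicHodge.fontainePstAdicCompletion v ℓ hv).IsDeRhamFramed (ρ.toLocal v))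 ∧ ∀ᶠ v : IsDedekindDomain.HeightOneSpectrum (NumberField.RingOfIntegers K) in Filter.cofinite, Summit.Langlands.SatakeFrobCompatibleAt ι π.1 ρ v) : ¬ _root_.Langlands :=
  fun hL ↦ h (ramifiedCoefficientSeed_stubWeakExistence_of_langlands hL)

/-- **stub B_w⁻ (`stub_weakAutomorphyOffSector`) is summit-implied**: direction (B), weak form, off the home
sector (the sector exclusion is simply unused). [folklore] -/
theorem ramifiedCoefficientSeed_stubWeakAutomorphyOffSector_of_langlands (hL : _root_.Langlands) : ∀ (K : Type) [Field K] [NumberField K] (n : ℕ) (hcpt : Literature.NumberTheory.Automorphic.isCompact_glFiniteIntegralLevel n K), 0 < n → ∀ (ℓ : ℕ) [Fact ℓ.Prime] (ι : PadicAlgCl ℓ ≃+* ℂ) (ρ : Literature.NumberTheory.GaloisRepresentations.FramedGaloisRep K (PadicAlgCl ℓ) n), ρ.toGaloisRep.IsIrreducible → ((∀ᶠ v : IsDedekindDomain.HeightOneSpectrum (NumberField.RingOfIntegers K) in Filter.cofinite, ρ.IsUnramifiedAt v) ∧ ∀ (v : IsDedekindDomain.HeightOneSpectrum (NumberField.RingOfIntegers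 K)) (hv : ((ℓ : ℕ) : NumberField.RingOfIntegers K) ∈ v.asIdeal), (Literature.NumberTheory.PAdicHodge.fontainePstAdicCompletion v ℓ hv).IsDeRhamFramed (ρ.toLocal v)) → ¬ (Module.finrank ℚ K = 1 ∧ n = 3 ∧ ¬ ∃ χ : Literature.NumberTheory.GaloisRepresentations.FramedGaloisRep K (PadicAlgCl ℓ) 1, ∀ σ, (ρ σ⁻¹).val.trace = (χ σ).val 0 0 * (ρ σ).val.trace) → ∃ π : Literature.NumberTheory.Automorphic.CuspidalAutomorphicRepData n K hcpt, π.1.IsLAlgebraic ∧ ∀ᶠ v : IsDedekindDomain.HeightOneSpectrum (NumberField.RingOfIntegers K) in Filter.cofinite, Summit.Langlands.SatakeFrobCompatibleAt ι π.1 ρ v := by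
  intro K _ _ n hcpt hn ℓ _ ι ρ hirr hgeo _hoff
  obtain ⟨⟨𝓡⟩, h⟩ := hL K
  obtain ⟨π, hLalg, hcorr⟩ := (h 𝓡 n hn hcpt).2 ℓ ι ρ hirr ⟨hgeo.1, fun v hv ↦ hgeo.2 v hv⟩
  exact ⟨π, hLalg, hcorr.1⟩

/-- … so a counterexample to stub B_w⁻ (e.g. an even irreducible geometric `ρ : Γ_ℚ → GL₂` with no cuspidal
`π`) refutes the formal summit. [folklore] -/
theorem ramifiedCoefficientSeed_not_langlands_of_not_stubWeakAutomorphyOffSector (h : ¬ ∀ (K : Type) [Field K] [NumberField K] (n : ℕ) (hcpt : Literature.NumberTheory.Automorphic.isCompact_glFiniteIntegralLevel n K), 0 < n → ∀ (ℓ : ℕ) [Fact ℓ.Prime] (ι : PadicAlgCl ℓ ≃+* ℂ) (ρ : Literature.NumberTheory.GaloisRepresentations.FramedGaloisRep K (PadicAlgCl ℓ) n), ρ.toGaloisRep.IsIrreducible → ((∀ᶠ v : IsDedekindDomain.HeightOneSpectrum (NumberField.RingOfIntegers K) in Filter.cofinite, ρ.IsUnramifiedAt v) ∧ ∀ (v :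 IsDedekindDomain.HeightOneSpectrum (NumberField.RingOfIntegers K)) (hv : ((ℓ : ℕ) : NumberField.RingOfIntegers K) ∈ v.asIdeal), (Literature.NumberTheory.PAdicHodge.fontainePstAdicCompletion v ℓ hv).IsDeRhamFramed (ρ.toLocal v)) → ¬ (Module.finrank ℚ K = 1 ∧ n = 3 ∧ ¬ ∃ χ : Literature.NumberTheory.GaloisRepresentations.FramedGaloisRep K (PadicAlgCl ℓ) 1, ∀ σ, (ρ σ⁻¹).val.trace = (χ σ).val 0 0 * (ρ σ).val.trace) → ∃ π : Literature.NumberTheory.Automorphic.CuspidalAutomorphicRepData n K hcpt, π.1.IsLAlgebraic ∧ ∀ᶠ v : IsDedekindDomain.HeightOneSpectrum (NumberField.RingOfIntegers K) in Filter.cofinite, Summit.Langlands.SatakeFrobCompatibleAt ι π.1 ρ v) : ¬ _root_.Langlands :=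
  fun hL ↦ h (ramifiedCoefficientSeed_stubWeakAutomorphyOffSector_of_langlands hL)

/-- **stub B_w⁺ (`stub_nonSelfDualRankThreeAutomorphy`, the HOME SECTOR in ∀-form) is summit-implied**:
direction (B) at `n = 3`; the degree-one and non-self-duality hypotheses are unused.  NB this stub is
Fontaine–Mazur–Langlands for EVERY irreducible geometric non-essentially-self-dual rank-3 `ρ` over a field of
degree 1 — the route's cruxes r2–r4 deliver only the explicit family inside it. [folklore] -/
theorem ramifiedCoefficientSeed_stubNonSelfDualRankThreeAutomorphy_of_langlands (hL : _root_.Langlands) : ∀ (K : Type) [Field K] [NumberField K], Module.finrank ℚ K = 1 → ∀ (hcpt : Literature.NumberTheory.Automorphic.isCompact_glFiniteIntegralLevel 3 K) (ℓ : ℕ) [Fact ℓ.Prime] (ι : PadicAlgCl ℓ ≃+* ℂ) (ρ : Literature.NumberTheory.GaloisRepresentations.FramedGaloisRep K (PadicAlgCl ℓ) 3), ρ.toGaloisRep.IsIrreducible → ((∀ᶠ v : IsDedekindDomain.HeightOneSpectrum (NumberField.RingOfIntegers K) in Filter.cofinite, ρ.IsUnramifiedAt v) ∧ ∀ (v : IsDedekindDomain.HeightOneSpectrum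 (NumberField.RingOfIntegers K)) (hv : ((ℓ : ℕ) : NumberField.RingOfIntegers K) ∈ v.asIdeal), (Literature.NumberTheory.PAdicHodge.fontainePstAdicCompletion v ℓ hv).IsDeRhamFramed (ρ.toLocal v)) → (¬ ∃ χ : Literature.NumberTheory.GaloisRepresentations.FramedGaloisRep K (PadicAlgCl ℓ) 1, ∀ σ, (ρ σ⁻¹).val.trace = (χ σ).val 0 0 * (ρ σ).val.trace) → ∃ π : Literature.NumberTheory.Automorphic.CuspidalAutomorphicRepData 3 K hcpt, π.1.IsLAlgebraic ∧ ∀ᶠ v : IsDedekindDomain.HeightOneSpectrum (NumberField.RingOfIntegers K) in Filter.cofinite, Summit.Langlands.SatakeFrobCompatibleAt ι π.1 ρ v := by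
  intro K _ _ _hK hcpt ℓ _ ι ρ hirr hgeo _hnsd
  obtain ⟨⟨𝓡⟩, h⟩ := hL K
  obtain ⟨π, hLalg, hcorr⟩ := (h 𝓡 3 (by norm_num) hcpt).2 ℓ ι ρ hirr ⟨hgeo.1, fun v hv ↦ hgeo.2 v hv⟩
  exact ⟨π, hLalg, hcorr.1⟩

/-- … so a counterexample to the home-sector stub (an irreducible geometric non-self-dual rank-3 `ρ` over `ℚ`
with no cuspidal `π`) refutes the formal summit. [folklore] -/
theorem ramifiedCoefficientSeed_not_langlands_of_not_stubNonSelfDualRankThreeAutomorphy (h : ¬ ∀ (K : Type) [Field K] [NumberField K], Module.finrank ℚ K = 1 → ∀ (hcpt : Literature.NumberTheory.Automorphic.isCompact_glFiniteIntegralLevel 3 K) (ℓ : ℕ) [Fact ℓ.Prime] (ι : PadicAlgCl ℓ ≃+* ℂ) (ρ : Literature.NumberTheory.GaloisRepresentations.FramedGaloisRep K (PadicAlgCl ℓ) 3), ρ.toGaloisRep.IsIrreducible → ((∀ᶠ v : IsDedekindDomain.HeightOneSpectrum (NumberField.RingOfIntegers K) in Filter.cofinite, ρ.IsUnramifiedAt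 v) ∧ ∀ (v : IsDedekindDomain.HeightOneSpectrum (NumberField.RingOfIntegers K)) (hv : ((ℓ : ℕ) : NumberField.RingOfIntegers K) ∈ v.asIdeal), (Literature.NumberTheory.PAdicHodge.fontainePstAdicCompletion v ℓ hv).IsDeRhamFramed (ρ.toLocal v)) → (¬ ∃ χ : Literature.NumberTheory.GaloisRepresentations.FramedGaloisRep K (PadicAlgCl ℓ) 1, ∀ σ, (ρ σ⁻¹).val.trace = (χ σ).val 0 0 * (ρ σ).val.trace) → ∃ π : Literature.NumberTheory.Automorphic.CuspidalAutomorphicRepData 3 K hcpt, π.1.IsLAlgebraic ∧ ∀ᶠ v : IsDedekindDomain.HeightOneSpectrum (NumberField.RingOfIntegers K) in Filter.cofinite, Summit.Langlands.SatakeFrobCompatibleAt ι π.1 ρ v) : ¬ _root_.Langlands :=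
  fun hL ↦ h (ramifiedCoefficientSeed_stubNonSelfDualRankThreeAutomorphy_of_langlands hL)

/-- **stub LGC (`stub_pairCompatibility`, every `𝓡`) is summit-implied**: (A) gives a corresponding avatar
`ρ₀` (LGC at every `v`); `ρ` and `ρ₀` are irreducible hence semisimple, have equal Satake parameters a.e.
(`hasSatakeParamAt_unique_holds`), hence equal Frobenius polynomials a.e., hence are equivalent (Chebotarev +
Brauer–Nesbitt, `nonempty_equiv_of_hasFrobCharpolyAt_eventually`), hence `ρ = P ρ₀ P⁻¹`
(`exists_eq_conj_of_equiv`), and `Corresponds` is invariant under change of frame (`corresponds_conj`,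
landed for crux 14328). [folklore] -/
theorem ramifiedCoefficientSeed_stubPairCompatibility_of_langlands (hL : _root_.Langlands) : ∀ (K : Type) [Field K] [NumberField K] (𝓡 : Summit.Langlands.ReciprocityData K) (n : ℕ) (hcpt : Literature.NumberTheory.Automorphic.isCompact_glFiniteIntegralLevel n K), 0 < n → ∀ (π : Literature.NumberTheory.Automorphic.CuspidalAutomorphicRepData n K hcpt), π.1.IsLAlgebraic → ∀ (ℓ : ℕ) [Fact ℓ.Prime] (ι : PadicAlgCl ℓ ≃+* ℂ) (ρ : Literature.NumberTheory.GaloisRepresentations.FramedGaloisRep K (PadicAlgCl ℓ) n), ρ.toGaloisRep.IsIrreducible → ((∀ᶠ v : IsDedekindDomain.HeightOneSpectrum (NumberField.RingOfIntegers K) in Filter.cofinite, ρ.IsUnramifiedAt v) ∧ ∀ (v : IsDedekindDomain.HeightOneSpectrum (NumberField.RingOfIntegers K)) (hv : ((ℓ : ℕ) : NumberField.RingOfIntegers K) ∈ v.asIdeal), (Literature.NumberTheory.PAdicHodge.fontainePstAdicCompletion v ℓ hv).IsDeRhamFramed (ρ.toLocal v)) → (∀ᶠ v : IsDedekindDomain.HeightOneSpectrum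 (NumberField.RingOfIntegers K) in Filter.cofinite, Summit.Langlands.SatakeFrobCompatibleAt ι π.1 ρ v) → ∀ v : IsDedekindDomain.HeightOneSpectrum (NumberField.RingOfIntegers K), Summit.Langlands.LocalGlobalCompatibleAt 𝓡 ι π.1 ρ v := by
  intro K _ _ 𝓡 n hcpt hn π hLalg ℓ _ ι ρ hirr _hgeo hsat v
  obtain ⟨-, h⟩ := hL K
  obtain ⟨ρ₀, hirr₀, -, hcorr₀, -⟩ := (h 𝓡 n hn hcpt).1 π hLalg ℓ ι
  have hs0 : ρ₀.toGaloisRep.IsSemisimple := by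
    haveI := hirr₀
    change ComplementedLattice _
    infer_instance
  have hs : ρ.toGaloisRep.IsSemisimple := by
    haveI := hirr
    change ComplementedLattice _
    infer_instance
  have hev : ∀ᶠ v : IsDedekindDomain.HeightOneSpectrum (NumberField.RingOfIntegers K) in Filter.cofinite,
      ρ₀.IsUnramifiedAt v ∧ ρ.IsUnramifiedAt v ∧
        ∃ P : Polynomial (PadicAlgCl ℓ), ρ₀.HasFrobCharpolyAt v P ∧ ρ.HasFrobCharpolyAt v P := by
    filter_upwards [hcorr₀.1, hsat] with v hv hv'
    obtain ⟨α, hα, hur, hcp⟩ := hv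
    obtain ⟨α', hα', hur', hcp'⟩ := hv'
    obtain rfl : α = α' := AutomorphicRepData.hasSatakeParamAt_unique_holds π.1 hα hα'
    exact ⟨hur, hur', _, hcp, hcp'⟩
  obtain ⟨e⟩ := FramedGaloisRep.nonempty_equiv_of_hasFrobCharpolyAt_eventually
    chebotarev_artinRep_holds ρ₀ ρ hs0 hs hev
  obtain ⟨P, hP⟩ := FramedRep.exists_eq_conj_of_equiv ρ₀ ρ e
  have hc : Summit.Langlands.Corresponds 𝓡 ι π.1 (FramedRep.conj P ρ₀) :=
    Summit.Langlands.Langlands.Theorems.ReciprocityUpToIrreducibility.corresponds_conj 𝓡 ι π.1 P hcorr₀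
  rw [← hP] at hc
  exact hc.2 v

/-- … so an a.e.-compatible irreducible pair `(π, ρ)` with a local mismatch at some finite place, for some
pinned reciprocity datum, refutes the formal summit. [folklore] -/
theorem ramifiedCoefficientSeed_not_langlands_of_not_stubPairCompatibility (h : ¬ ∀ (K : Type) [Field K] [NumberField K] (𝓡 : Summit.Langlands.ReciprocityData K) (n : ℕ) (hcpt : Literature.NumberTheory.Automorphic.isCompact_glFiniteIntegralLevel n K), 0 < n → ∀ (π : Literature.NumberTheory.Automorphic.CuspidalAutomorphicRepData n K hcpt), π.1.IsLAlgebraic → ∀ (ℓ : ℕ) [Fact ℓ.Prime] (ι : PadicAlgCl ℓ ≃+* ℂ) (ρ : Literature.NumberTheory.GaloisRepresentations.FramedGaloisRep K (PadicAlgCl ℓ) n), ρ.toGaloisRep.IsIrreducible → ((∀ᶠ v : IsDedekindDomain.HeightOneSpectrum (NumberField.RingOfIntegers K) in Filter.cofinite, ρ.IsUnramifiedAt v) ∧ ∀ (v : IsDedekindDomain.HeightOneSpectrum (NumberField.RingOfIntegers K)) (hv : ((ℓ : ℕ) : NumberField.RingOfIntegers K) ∈ v.asIdeal), (Literature.NumberTheory.PAdicHodge.fontainePstAdicCompletion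 v ℓ hv).IsDeRhamFramed (ρ.toLocal v)) → (∀ᶠ v : IsDedekindDomain.HeightOneSpectrum (NumberField.RingOfIntegers K) in Filter.cofinite, Summit.Langlands.SatakeFrobCompatibleAt ι π.1 ρ v) → ∀ v : IsDedekindDomain.HeightOneSpectrum (NumberField.RingOfIntegers K), Summit.Langlands.LocalGlobalCompatibleAt 𝓡 ι π.1 ρ v) : ¬ _root_.Langlands :=
  fun hL ↦ h (ramifiedCoefficientSeed_stubPairCompatibility_of_langlands hL)

/-- **stub RD (`stub_reciprocityData`) is the summit's first conjunct.** [folklore] -/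
theorem ramifiedCoefficientSeed_stubReciprocityData_of_langlands (hL : _root_.Langlands) :
    ∀ (K : Type) [Field K] [NumberField K], Nonempty (Summit.Langlands.ReciprocityData K) :=
  fun K _ _ ↦ (hL K).1

/-- … so an EMPTY `ReciprocityData K` (an unsatisfiable `LocalLanglandsDatum (K_v)` as typed) refutes the
formal summit — the Statement's own fail-safe. [folklore] -/
theorem ramifiedCoefficientSeed_not_langlands_of_not_stubReciprocityData
    (h : ¬ ∀ (K : Type) [Field K] [NumberField K], Nonempty (Summit.Langlands.ReciprocityData K)) :
    ¬ _root_.Langlands :=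
  fun hL ↦ h (ramifiedCoefficientSeed_stubReciprocityData_of_langlands hL)

end Summit.Langlands.Langlands.Theorems
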